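import Mathlib
import Summits.MatrixMultiplication.MatrixMultiplication.Theses.MatrixPointInterpolation
import Literature.Computability.AlgebraicComplexity.TensorRestrictionRank
import Literature.Computability.AlgebraicComplexity.TensorMultiples

/-!
# `MatrixPointInterpolation.InterpolationLemma` (stmt-MatrixMultiplication-18941) — proved

The interpolation lemma of route `MatrixMultiplication/MatrixPointInterpolation` (the commutative
diagram of Bürgisser–Clausen–Shokrollahi 1997, Prop. 18.22, transferred to matrix points): let
`A : Fin m → M_n(ℂ)` be an `m`-tuple of `n × n` matrices whose words of length `≤ d` span `M_n(ℂ)`,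
and let `B t : Fin m → M_k(ℂ)` (`t : Fin N`) be `N` points such that every linear combination of
words of length `≤ 2d` vanishing at all `N` points vanishes at `A`.  Then `⟨n,n,n⟩` is a restriction
of `⟨N⟩ ⊗ ⟨k,k,k⟩` (`N` disjoint copies of `⟨k,k,k⟩`), hence `R(⟨n,n,n⟩) ≤ N · R(⟨k,k,k⟩)`.

Proof (bilinear algorithm):
* the window hypothesis makes the evaluation `w ↦ w(A)` factor *linearly* through the joint
  evaluation `w ↦ (w(B t))_t` on words of length `≤ 2d`: there is a linear read-out
  `φ : (Fin N → M_k) →ₗ M_n` with `φ ((w(B t))_t) = w(A)` (`exists_linearMap_apply_eq_of_linearCombination`,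
  kernel inclusion + extension from the range);
* the spanning hypothesis writes each elementary matrix `E_b = ∑ᵢ fᵢ • wᵢ(A)` with `|wᵢ| ≤ d`;
  put `P_b(t) := ∑ᵢ fᵢ • wᵢ(B t) ∈ M_k`;
* concatenating words (`|u ++ v| ≤ 2d`) gives the key identity `E_b E_c = φ (t ↦ P_b(t) P_c(t))`;
* in coordinates this is exactly a restriction `⟨N⟩ ⊗ ⟨k,k,k⟩ ≥ ⟨n,n,n⟩`
  (`TensorRestrictsTo`), and `R` is monotone under restriction
  (`TensorRestrictsTo.tensorRank_le`) and subadditive on copies (`tensorRank_multiple_le`).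

References: P. Bürgisser, M. Clausen, M. A. Shokrollahi, *Algebraic Complexity Theory* (1997),
Prop. 18.22 and Prop. 14.23; M. Bläser, *Fast Matrix Multiplication* (2013), Lemma 5.4, §7.
-/

-- `Summit.MatrixMultiplication.MatrixMultiplication.…` is the tree's mandated summit-side namespace
-- (single-conjunct summit: Sub = Summit), which the `dupNamespace` linter would flag on every decl.
set_option linter.dupNamespace false

namespace Summit.MatrixMultiplication.MatrixMultiplication.Theorems

open Literature.Computability.AlgebraicComplexity

/-- **Linear maps with prescribed, linearly compatible values.** If every linear relation among the
vectors `v a` also holds among the prescribed values `u a`, then some linear map sends each `v a`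
to `u a` (factor `linearCombination u` through the range of `linearCombination v`, then extend from
that subspace to the whole space). [folklore] -/
theorem exists_linearMap_apply_eq_of_linearCombination {K V W α : Type*} [Field K]
    [AddCommGroup V] [Module K V] [AddCommGroup W] [Module K W] (v : α → V) (u : α → W)
    (h : ∀ l : α →₀ K, Finsupp.linearCombination K v l = 0 →
      Finsupp.linearCombination K u l = 0) :
    ∃ φ : V →ₗ[K] W, ∀ a, φ (v a) = u a := by
  have hker : LinearMap.ker (Finsupp.linearCombination K v) ≤
      LinearMap.ker (Finsupp.linearCombination K u) :=
    fun l hl => LinearMap.mem_ker.2 (h l (LinearMap.mem_ker.1 hl))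
  obtain ⟨g, hg⟩ := LinearMap.exists_extend
    (((LinearMap.ker (Finsupp.linearCombination K v)).liftQ (Finsupp.linearCombination K u)
      hker).comp (Finsupp.linearCombination K v).quotKerEquivRange.symm.toLinearMap)
  refine ⟨g, fun a => ?_⟩
  have hmem : Finsupp.linearCombination K v (Finsupp.single a 1) ∈
      LinearMap.range (Finsupp.linearCombination K v) := LinearMap.mem_range_self _ _
  have hva : v a = (LinearMap.range (Finsupp.linearCombination K v)).subtype
      ⟨Finsupp.linearCombination K v (Finsupp.single a 1), hmem⟩ := by
    simp
  rw [hva, ← LinearMap.comp_apply, hg]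
  simp only [LinearMap.coe_comp, Function.comp_apply, LinearEquiv.coe_coe,
    LinearMap.quotKerEquivRange_symm_apply_image, Submodule.mkQ_apply, Submodule.liftQ_apply]
  simp

/-- The product of two linear combinations of word-evaluations is the linear combination, over
pairs, of the evaluations of the concatenated words. [folklore] -/
theorem sum_smul_wordProd_mul_sum_smul_wordProd {R : Type*} [Ring R] [Algebra ℂ R] {m : ℕ}
    (X : Fin m → R) {ι₁ ι₂ : Type*} [Fintype ι₁] [Fintype ι₂] (f : ι₁ → ℂ)
    (u : ι₁ → List (Fin m)) (g : ι₂ → ℂ) (v : ι₂ → List (Fin m)) :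
    (∑ i, f i • ((u i).map X).prod) * (∑ j, g j • ((v j).map X).prod) =
      ∑ i, ∑ j, (f i * g j) • ((u i ++ v j).map X).prod := by
  rw [Finset.sum_mul_sum]
  refine Finset.sum_congr rfl fun i _ => Finset.sum_congr rfl fun j _ => ?_
  rw [List.map_append, List.prod_append, smul_mul_smul_comm]

/-- Summing a kernel `G` against `⟨N⟩ ⊗ ⟨k₁,k₂,k₃⟩` collapses the triple sum onto the support of
that `0/1` tensor: the triples `((p,(i,j)), (p,(i,l)), (p,(l,j)))`. [folklore] -/
theorem sum_mul_multiple_matMulTensor {K : Type*} [CommSemiring K] {N k₁ k₂ k₃ : ℕ}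
    (G : (Fin N × (Fin k₁ × Fin k₃)) → (Fin N × (Fin k₁ × Fin k₂)) →
      (Fin N × (Fin k₂ × Fin k₃)) → K) :
    ∑ a, ∑ b, ∑ c, G a b c * kroneckerTensor (unitTensor K N) (matMulTensor K k₁ k₂ k₃) a b c =
      ∑ a, ∑ l : Fin k₂, G a (a.1, (a.2.1, l)) (a.1, (l, a.2.2)) := by
  refine Finset.sum_congr rfl fun a _ => ?_
  have hc : ∀ b : Fin N × (Fin k₁ × Fin k₂),
      ∑ c, G a b c * kroneckerTensor (unitTensor K N) (matMulTensor K k₁ k₂ k₃) a b c =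
        if b.1 = a.1 ∧ b.2.1 = a.2.1 then G a b (a.1, (b.2.2, a.2.2)) else 0 := by
    intro b
    rw [Finset.sum_eq_single (a.1, (b.2.2, a.2.2))]
    · simp only [kroneckerTensor_unitTensor_apply, matMulTensor]
      by_cases h1 : b.1 = a.1
      · by_cases h2 : b.2.1 = a.2.1
        · simp [h1, h2]
        · simp [h1, h2, Ne.symm h2]
      · simp [h1, Ne.symm h1]
    · rintro ⟨r, l', j'⟩ _ hne
      simp only [kroneckerTensor_unitTensor_apply, matMulTensor, ne_eq, Prod.mk.injEq] at hne ⊢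
      split_ifs with h1 h2
      · exact absurd ⟨(h1.1.trans h1.2).symm, h2.2.1.symm, h2.2.2.symm⟩ hne
      · simp
      · simp
    · simp
  simp_rw [hc]
  rw [Fintype.sum_prod_type, Finset.sum_eq_single a.1]
  · rw [Fintype.sum_prod_type, Finset.sum_eq_single a.2.1]
    · simp
    · intro i _ hi
      exact Finset.sum_eq_zero fun l _ => by simp [hi]
    · simp
  · intro q _ hq
    exact Finset.sum_eq_zero fun il _ => by simp [hq]
  · simp

/-- An `N`-tuple of matrices is the sum of its entries times the elementary tuples
`Pi.single p (Matrix.single i j 1)`. [folklore] -/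
theorem pi_matrix_eq_sum_smul_single {K : Type*} [CommSemiring K] {N k₁ k₂ : ℕ}
    (v : Fin N → Matrix (Fin k₁) (Fin k₂) K) :
    v = ∑ a : Fin N × (Fin k₁ × Fin k₂),
      v a.1 a.2.1 a.2.2 • (Pi.single a.1 (Matrix.single a.2.1 a.2.2 (1 : K)) :
        Fin N → Matrix (Fin k₁) (Fin k₂) K) := by
  funext t
  ext i j
  rw [Finset.sum_apply, Matrix.sum_apply, Fintype.sum_prod_type, Finset.sum_eq_single t]
  · rw [Fintype.sum_prod_type, Finset.sum_eq_single i]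
    · rw [Finset.sum_eq_single j]
      · simp
      · intro j' _ hj
        simp [hj]
      · simp
    · intro i' _ hi
      exact Finset.sum_eq_zero fun j' _ => by simp [hi]
    · simp
  · intro t' _ ht
    exact Finset.sum_eq_zero fun ij _ => by simp [ht]
  · simp

/-- **The interpolation lemma** (BCS 1997, Prop. 18.22, transferred to matrix points; route
`MatrixPointInterpolation`, item stmt-MatrixMultiplication-18941): if the words of length `≤ d` in
`A : Fin m → M_n(ℂ)` span `M_n(ℂ)` and evaluation at `A` of linear combinations of words of length
`≤ 2d` factors through the evaluations at `N` points `B t : Fin m → M_k(ℂ)`, then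
`R(⟨n,n,n⟩) ≤ N · R(⟨k,k,k⟩)`: `⟨n,n,n⟩ ≤ ⟨N⟩ ⊗ ⟨k,k,k⟩` by lifting `x, y ∈ M_n` to word-combinations
of length `≤ d`, multiplying at each point and reading the product back through the linear
factorisation. [cite: BurgisserClausenShokrollahi1997, Prop. 18.22] -/
theorem interpolationLemma_proof :
    Summit.MatrixMultiplication.MatrixMultiplication.Theses.MatrixPointInterpolation.InterpolationLemma := by
  intro n k m d N A B hspan hwin
  classical
  -- Step 1: the linear read-out `φ` through the `N` points (window hypothesis).
  obtain ⟨φ, hφ⟩ : ∃ φ : (Fin N → Matrix (Fin k) (Fin k) ℂ) →ₗ[ℂ] Matrix (Fin n) (Fin n) ℂ,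
      ∀ w : List (Fin m), w.length ≤ 2 * d →
        φ (fun t => (w.map (B t)).prod) = (w.map A).prod := by
    obtain ⟨v, hv⟩ : ∃ v : List (Fin m) → (Fin N → Matrix (Fin k) (Fin k) ℂ),
        ∀ w, v w = if w.length ≤ 2 * d then (fun t => (w.map (B t)).prod) else 0 :=
      ⟨_, fun _ => rfl⟩
    obtain ⟨u, hu⟩ : ∃ u : List (Fin m) → Matrix (Fin n) (Fin n) ℂ,
        ∀ w, u w = if w.length ≤ 2 * d then (w.map A).prod else 0 :=
      ⟨_, fun _ => rfl⟩
    have hcompat : ∀ l : List (Fin m) →₀ ℂ, Finsupp.linearCombination ℂ v l = 0 →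
        Finsupp.linearCombination ℂ u l = 0 := by
      intro l hl
      have hTlen : ∀ w ∈ l.support.filter (fun w => w.length ≤ 2 * d), w.length ≤ 2 * d :=
        fun w hw => (Finset.mem_filter.1 hw).2
      have hv' : Finsupp.linearCombination ℂ v l =
          ∑ w ∈ l.support.filter (fun w => w.length ≤ 2 * d),
            l w • (fun t => (w.map (B t)).prod) := by
        rw [Finsupp.linearCombination_apply, Finsupp.sum, Finset.sum_filter]
        refine Finset.sum_congr rfl fun w _ => ?_
        rw [hv]
        split_ifs <;> simp
      have hu' : Finsupp.linearCombination ℂ u l =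
          ∑ w ∈ l.support.filter (fun w => w.length ≤ 2 * d), l w • (w.map A).prod := by
        rw [Finsupp.linearCombination_apply, Finsupp.sum, Finset.sum_filter]
        refine Finset.sum_congr rfl fun w _ => ?_
        rw [hu]
        split_ifs <;> simp
      rw [hu']
      refine hwin _ l hTlen fun t => ?_
      have := congr_fun (hv'.symm.trans hl) t
      simpa [Finset.sum_apply] using this
    obtain ⟨φ, hφ⟩ := exists_linearMap_apply_eq_of_linearCombination v u hcompat
    refine ⟨φ, fun w hw => ?_⟩
    have := hφ w
    rwa [hv, hu, if_pos hw, if_pos hw] at this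
  -- Step 2: elementary matrices as combinations of words of length `≤ d` (spanning hypothesis).
  have hrep : ∀ b : Fin n × Fin n, ∃ (r : ℕ) (f : Fin r → ℂ) (wd : Fin r → List (Fin m)),
      (∀ i, (wd i).length ≤ d) ∧
        ∑ i, f i • ((wd i).map A).prod = Matrix.single b.1 b.2 (1 : ℂ) := by
    intro b
    have hmem : Matrix.single b.1 b.2 (1 : ℂ) ∈ Submodule.span ℂ
        {M : Matrix (Fin n) (Fin n) ℂ | ∃ w : List (Fin m), w.length ≤ d ∧ (w.map A).prod = M} := by
      rw [hspan]; exact Submodule.mem_top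
    obtain ⟨r, f, g, hsum⟩ := Submodule.mem_span_set'.1 hmem
    have hg : ∀ i, ∃ w : List (Fin m), w.length ≤ d ∧ (w.map A).prod = (g i : Matrix _ _ ℂ) :=
      fun i => (g i).2
    choose wd hwd_len hwd_eq using hg
    refine ⟨r, f, wd, hwd_len, ?_⟩
    rw [← hsum]
    exact Finset.sum_congr rfl fun i _ => by rw [hwd_eq]
  choose r f wd hlen hsum using hrep
  -- Step 3: point values and the key identity `E_b E_c = φ (t ↦ P_b(t) P_c(t))`.
  obtain ⟨pv, hpv⟩ : ∃ pv : (Fin n × Fin n) → Fin N → Matrix (Fin k) (Fin k) ℂ,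
      ∀ b t, pv b t = ∑ i, f b i • ((wd b i).map (B t)).prod := ⟨_, fun _ _ => rfl⟩
  have hlen2 : ∀ (b c : Fin n × Fin n) (i : Fin (r b)) (j : Fin (r c)),
      (wd b i ++ wd c j).length ≤ 2 * d := fun b c i j => by
    rw [List.length_append]; have := hlen b i; have := hlen c j; omega
  have key : ∀ b c : Fin n × Fin n,
      Matrix.single b.1 b.2 (1 : ℂ) * Matrix.single c.1 c.2 (1 : ℂ) =
        φ (fun t => pv b t * pv c t) := by
    intro b c
    have hW : (fun t => pv b t * pv c t) =
        ∑ i, ∑ j, (f b i * f c j) • (fun t => ((wd b i ++ wd c j).map (B t)).prod) := by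
      funext t
      simp only [Finset.sum_apply, Pi.smul_apply, hpv]
      exact sum_smul_wordProd_mul_sum_smul_wordProd _ _ _ _ _
    rw [hW, map_sum, ← hsum b, ← hsum c, sum_smul_wordProd_mul_sum_smul_wordProd]
    refine Finset.sum_congr rfl fun i _ => ?_
    rw [map_sum]
    refine Finset.sum_congr rfl fun j _ => ?_
    rw [map_smul, hφ _ (hlen2 b c i j)]
  -- Step 4: the restriction `⟨N⟩ ⊗ ⟨k,k,k⟩ ≥ ⟨n,n,n⟩` and the rank bound.
  have hres : TensorRestrictsTo (kroneckerTensor (unitTensor ℂ N) (matMulTensor ℂ k k k))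
      (matMulTensor ℂ n n n) := by
    refine ⟨fun a' a => φ (Pi.single a.1 (Matrix.single a.2.1 a.2.2 (1 : ℂ))) a'.1 a'.2,
      fun b' b => pv b' b.1 b.2.1 b.2.2, fun c' c => pv c' c.1 c.2.1 c.2.2, fun a' b' c' => ?_⟩
    refine Eq.trans ?_ (sum_mul_multiple_matMulTensor (fun a b c =>
      φ (Pi.single a.1 (Matrix.single a.2.1 a.2.2 (1 : ℂ))) a'.1 a'.2 *
        pv b' b.1 b.2.1 b.2.2 * pv c' c.1 c.2.1 c.2.2)).symm
    dsimp only
    -- left-hand side: the entry of `E_{b'} E_{c'}`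
    have lhs : matMulTensor ℂ n n n a' b' c' =
        (Matrix.single b'.1 b'.2 (1 : ℂ) * Matrix.single c'.1 c'.2 (1 : ℂ)) a'.1 a'.2 := by
      obtain ⟨κ', ν'⟩ := a'
      obtain ⟨κ, μ⟩ := b'
      obtain ⟨μ', ν⟩ := c'
      dsimp only
      by_cases h : μ = μ'
      · subst h
        rw [Matrix.single_mul_single_same, one_mul, Matrix.single_apply]
        by_cases h1 : κ' = κ
        · subst h1
          by_cases h2 : ν' = ν
          · subst h2; simp [matMulTensor]
          · simp [matMulTensor, h2, Ne.symm h2]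
        · simp [matMulTensor, h1, Ne.symm h1]
      · rw [Matrix.single_mul_single_of_ne (h := h), Matrix.zero_apply]
        simp [matMulTensor, h]
    rw [lhs, key]
    have hv := pi_matrix_eq_sum_smul_single (fun t => pv b' t * pv c' t)
    rw [hv, map_sum, Matrix.sum_apply]
    refine Finset.sum_congr rfl fun a _ => ?_
    rw [map_smul, Matrix.smul_apply, smul_eq_mul, Matrix.mul_apply, Finset.sum_mul]
    refine Finset.sum_congr rfl fun l _ => ?_
    ring
  calc tensorRank (matMulTensor ℂ n n n)
      ≤ tensorRank (kroneckerTensor (unitTensor ℂ N) (matMulTensor ℂ k k k)) := hres.tensorRank_le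
    _ ≤ N * tensorRank (matMulTensor ℂ k k k) := tensorRank_multiple_le N _

end Summit.MatrixMultiplication.MatrixMultiplication.Theorems
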